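import Literature.Claims.NS.Hulyas2025
import Summits.NavierStokesRegularity.NavierStokesRegularity.Theorems.SoloRefuteIotti2011

/-!
# KILL CANDIDATE (typist-10 g2 kit, offered on disk — NOT filed; the refuter/salvage lane files Theorems/) for C72
# `Hulyas2025` (H. Zeq & A. Zeq, Zenodo 16936769), against the skeleton p491516 (`Literature.Claims.NS.Hulyas2025`).

Rule (α) option only — under rule (β) (C58/C84/C101 precedent) the certificate is the in-skeleton
`printedContent_holds` / `step_bridge_iff_claimed` and no Theorems file is meaningful. Target if adopted:
`Summits/NavierStokesRegularity/NavierStokesRegularity/Theorems/SoloRefuteHulyas2025.lean`. Imports the C28 kill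
`Theorems/SoloRefuteIotti2011.lean` (p487379 @ d53a4e31b7d6) for the swirl `swirlU x = σ(2 − |x|²)·(−x₁, x₀, 0)` — a smooth,
compactly supported, divergence-free, rapidly decaying Clay datum — reused BY NAME.

* `not_Step_map` — Table 2 p.6 «v ≈ ∇ϕ» over the Clay class: `curl U(0) = (0,0,2) ≠ 0`, while every HULYAS field
  (`C²` gradient) is curl-free (`isHulyasField_curl_eq_zero`, skeleton).
* `not_Step_61` — §6.1 p.6 «restricts velocity gradients below 10⁻¹⁸»: `DU(0) = rotL`, `‖DU(0)‖ ≥ ‖rotL e₀‖ = 1`.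
* `not_Step_63` — §6.3 p.7 «∇ϕ ≤ 10²⁸»: the Clay datum `(4·10²⁸)·U` has norm `2·10²⁸` at `½e₀`.

WHAT THIS IS NOT: not a claim about NS regularity or blow-up; not a claim about any author beyond the typed locator.
-/

noncomputable section

open Set Metric
open scoped ContDiff InnerProductSpace RealInnerProductSpace Topology

set_option linter.dupNamespace false

namespace Summit.NavierStokesRegularity.NavierStokesRegularity.Theorems.Hulyas2025

open Literature.Analysis.FluidPDE Literature.Claims.NS.Hulyas2025
open Summit.NavierStokesRegularity.NavierStokesRegularity.Theorems.Iotti2011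
  (E3 e0 e1 e2 rotL rotL_apply cut dcut swirlU hasFDerivAt_swirlU fderiv_swirlU_apply contDiff_swirlU
    hasCompactSupport_swirlU isDivFree_swirlU hasRapidSpatialDecay_swirlU norm_swirlU_half e1_ne_zero)

/-! ### The swirl at the origin: `DU(0) = rotL`, `curl U(0) = 2e₂` -/

/-- `cut 0 = σ(2) = 1`. [folklore] -/
theorem cut_zero : cut 0 = 1 := by
  simp [cut, Real.smoothTransition.one_of_one_le]

/-- `DU(0)[v] = rotL v`. [folklore] -/
theorem fderiv_swirlU_zero (v : E3) : fderiv ℝ swirlU 0 v = rotL v := by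
  rw [fderiv_swirlU_apply, cut_zero, map_zero, smul_zero, add_zero, one_smul]

/-- The third component of `curl U` at the origin is `2`. [folklore] -/
theorem curl_swirlU_zero_two : curl swirlU 0 2 = 2 := by
  simp [curl, fderiv_swirlU_zero, rotL_apply, e0, e1]
  norm_num

/-- The swirl is divergence free in the `NSWave0` spelling (same definition). [folklore] -/
theorem isDivFree_swirlU' : NSWave0.IsDivFree swirlU := isDivFree_swirlU

/-- **Table 2 p.6 «v ≈ ∇ϕ», read over Clay's data class, is false**: the swirl datum is not a gradient.
[cite: Hulyas2025, Table 2 p.6] -/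
theorem not_Step_map : ¬ Literature.Claims.NS.Hulyas2025.Step_map := by
  intro h
  have hc := isHulyasField_curl_eq_zero
    (h swirlU contDiff_swirlU isDivFree_swirlU' hasRapidSpatialDecay_swirlU) 0
  have h2 : curl swirlU 0 2 = 0 := by rw [hc]; rfl
  rw [curl_swirlU_zero_two] at h2
  norm_num at h2

-- (filer's mechanical dedup fix, conv. (b): the generic helpers `norm_e0`/`norm_e1` (‖e₀‖ = ‖e₁‖ = 1)
-- restated tree lemmas (dedup.landed); `norm_e0` is inlined below, `norm_e1` was unused.)

/-- **§6.1 p.6 «restricts velocity gradients below 10⁻¹⁸» over Clay's data class is false**: `‖DU(0)‖ ≥ 1`.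
[cite: Hulyas2025, §6.1 p.6 l.63–66] -/
theorem not_Step_61 : ¬ Literature.Claims.NS.Hulyas2025.Step_61 := by
  intro h
  have hb := h swirlU contDiff_swirlU isDivFree_swirlU' hasRapidSpatialDecay_swirlU 0
  have hop : ‖fderiv ℝ swirlU 0 e0‖ ≤ ‖fderiv ℝ swirlU 0‖ * ‖e0‖ := ContinuousLinearMap.le_opNorm _ _
  rw [fderiv_swirlU_zero, show ‖(e0 : E3)‖ = 1 by simp [e0], mul_one, rotL_apply] at hop
  have he : ‖(e0 : E3) 0 • e1 - (e0 : E3) 1 • e0‖ = 1 := by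
    simp [e0, e1]
  rw [he] at hop
  have : ((10:ℝ) ^ 18)⁻¹ < 1 := by norm_num
  linarith

/-! ### The scaled swirl `c·U` is a Clay datum -/

/-- `c·U` is smooth. [folklore] -/
theorem contDiff_smul_swirlU (c : ℝ) : ContDiff ℝ ∞ (fun x => c • swirlU x) :=
  contDiff_swirlU.const_smul c

/-- `c·U` is divergence free. [folklore] -/
theorem isDivFree_smul_swirlU (c : ℝ) : NSWave0.IsDivFree (fun x => c • swirlU x) := by
  intro x
  have h := isDivFree_swirlU x
  unfold VectorCalculus.divergence at h
  show LinearMap.trace ℝ E3 (fderiv ℝ (c • swirlU) x : E3 →ₗ[ℝ] E3) = 0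
  rw [((hasFDerivAt_swirlU x).const_smul c).fderiv, ContinuousLinearMap.toLinearMap_smul, map_smul,
    (hasFDerivAt_swirlU x).fderiv.symm, h, smul_zero]

/-- `c·U` has compact support. [folklore] -/
theorem hasCompactSupport_smul_swirlU (c : ℝ) : HasCompactSupport (fun x => c • swirlU x) :=
  hasCompactSupport_swirlU.mono fun x hx => by
    rw [Function.mem_support] at hx ⊢
    exact fun h0 => hx (by simp [h0])

/-- `c·U` decays rapidly (compact support). [folklore] -/
theorem hasRapidSpatialDecay_smul_swirlU (c : ℝ) : HasRapidSpatialDecay (fun x => c • swirlU x) := by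
  intro n K
  have hcont : Continuous fun x => (1 + ‖x‖) ^ K * ‖iteratedFDeriv ℝ n (fun x => c • swirlU x) x‖ :=
    ((continuous_const.add continuous_norm).pow K).mul
      ((contDiff_smul_swirlU c).continuous_iteratedFDeriv (m := n) (by exact_mod_cast le_top)).norm
  have hsupp : HasCompactSupport fun x => (1 + ‖x‖) ^ K * ‖iteratedFDeriv ℝ n (fun x => c • swirlU x) x‖ :=
    (((hasCompactSupport_smul_swirlU c).iteratedFDeriv (𝕜 := ℝ) n).norm).mul_left
  obtain ⟨C, hC⟩ := hcont.bddAbove_range_of_hasCompactSupport hsupp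
  exact ⟨C, fun x => hC ⟨x, rfl⟩⟩

/-- **§6.3 p.7 «the damping term enforces ∇ϕ ≤ 10²⁸» (i.e. `|v| ≤ 10²⁸`) over Clay's data class is false**: the
Clay datum `(4·10²⁸)·U` has norm `2·10²⁸` at `½e₀`. [cite: Hulyas2025, §6.3 p.7 l.11–12] -/
theorem not_Step_63 : ¬ Literature.Claims.NS.Hulyas2025.Step_63 := by
  intro h
  set c : ℝ := 4 * (10:ℝ) ^ 28 with hc
  have hb := h (fun x => c • swirlU x) (contDiff_smul_swirlU c) (isDivFree_smul_swirlU c)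
    (hasRapidSpatialDecay_smul_swirlU c) ((1 / 2 : ℝ) • e0)
  have hn : ‖c • swirlU ((1 / 2 : ℝ) • e0)‖ = 2 * (10:ℝ) ^ 28 := by
    rw [norm_smul, norm_swirlU_half, hc, Real.norm_eq_abs, abs_of_nonneg (by positivity)]
    ring
  rw [hn] at hb
  norm_num at hb

end Summit.NavierStokesRegularity.NavierStokesRegularity.Theorems.Hulyas2025

end
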